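import Summits.ABC.ABC.Theses.IsogenyGlueCongruence
import Summits.ABC.ABC.Theorems.IsogenyGlueCongruencePolyDegreeOfBoundedPrimesHeightCalibrationExact
import Summits.ABC.ABC.Theorems.IsogenyGlueCongruenceSharpDegreeOfPolyHeightPosition
import Summits.ABC.ABC.Theorems.IsogenyGlueCongruencePolyDegreeOfBoundedPrimesOfHeightAndManinItems
import Summits.ABC.ABC.Theorems.IsogenyGlueCongruencePolyDegreeOfBoundedPrimesHeightForms

/-!
# Strategist census r1 — crux B `PolyDegreeOfBoundedPrimes` (stmt-ABC-2046): the position theorems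

Crux-strategist r1 (second opinion, planner-cstrat-stmt-ABC-2046-r1-0, 2026-08-17). Companion of
`STRATEGY-CENSUS.md` (r1 revision). Sorry-free. Nothing here is a line or a stub: these are the
kernel-checked POSITION statements the census and the tribunal rely on, assembled from landed
Theorems, plus the typed forms of the r1 census attempts (definitions only).

* `crux_of_abc_of_manin`    — S → C: the summit implies the crux, modulo the known-in-print Manin
                               item `SemistableManinBound2` (stmt-ABC-16014).  (BC2 converse probe.)
* `polyAbc_of_lowerCone`     — what CLOSING the crux buys inside the route: the six lower binders of
                               `closes` (U, J, MK, Mod, HofMK, GlueU) together with B already give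
                               polynomial abc on Serre-normalised triples — no Petersson / Sharp /
                               Frame input.  This is the "summit-class" certificate: on the branch
                               where the route's lever delivers crux A, B is polynomial Szpiro.
* `crux_iff_residual_of_manin` — B ↔ B′ modulo the Manin item (alias of the landed theorem).
* `residual_iff_logHeight`   — granted A, B′'s consequent is `h_F ≤ a log N + b` (alias).
-/

noncomputable section

set_option linter.dupNamespace false

namespace Summit.ABC.ABC.Cruxes.PolyDegreeOfBoundedPrimes.StrategistCensusR1

open Summit.ABC.ABC.Theses.IsogenyGlueCongruence
open Literature.NumberTheory.EllipticCurves Literature.NumberTheory.EllipticCurves.ModularForms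
open Literature.NumberTheory.DiophantineGeometry
open WeierstrassCurve

/-- **S → C (modulo the Manin item).** The summit `ABC` implies crux B, given the known-in-print
support item `SemistableManinBound2` (Edixhoven 1991 Prop. 2 — a tree theorem —, Česnavičius 2018
Thm 1.2, Mazur 1978 + Kenku 1982): `ABC → H` (`SharpDegreeOfPolyHeight.polyHeight_of_abc`, via the
Bombieri–Gubler generalized Szpiro conjecture, Thm 12.5.12 proved in tree), `H → B′` trivially, and
`SMB2 → B′ → B` (p137484). So B is a CONSEQUENCE of the summit: refuting B refutes ABC. -/
theorem crux_of_abc_of_manin (hMan : SemistableManinBound2) (h : _root_.ABC) :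
    PolyDegreeOfBoundedPrimes :=
  Summit.ABC.ABC.Theorems.polyDegreeOfBoundedPrimes_of_semistableManinBound2_of_polyHeightOfBoundedPrimes
    hMan (fun _ => Summit.ABC.ABC.Theorems.SharpDegreeOfPolyHeight.polyHeight_of_abc h)

/-- **What closing B buys (summit-class certificate).** The six LOWER binders of the route's deciding
theorem (`closes hU hJ hMK hMod hHofMK hGlueU hB …`) together with crux B already yield POLYNOMIAL abc
on Serre-normalised triples `(AB(A+B))² ≤ C·N^σ` (`N` = conductor of the Frey curve = rad):
`A_crux = hGlueU hU hJ (hHofMK hMK hMod)` and `polyAbcNormalized_of_polyDegreeOfBoundedPrimes`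
(B → A → H → polynomial abc, p102896 + calibration).  Of these binders J, MK, Mod, HofMK, GlueU are
known in print or proved; so on the branch where the lever U holds, proving B is proving a
polynomial-abc-strength statement (weak abc with SOME exponent — open; unconditional state of the art
exponential, Stewart–Yu 2001; catalogued benchmark `Literature.Barriers.ABC.BakerMethodBounds`). -/
theorem polyAbc_of_lowerCone (hU : EllipticGluingPrimeBound) (hJ : ModularJacobianMultipliers)
    (hMK : MazurKenkuBound) (hMod : ModularDatumExists)
    (hHofMK : SemistableHeightPolyBoundOfMazurKenku) (hGlueU : DegreePrimesOfGluingBound)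
    (hB : PolyDegreeOfBoundedPrimes) :
    ∃ σ C : ℝ, ∀ A B : ℤ, IsCoprime A B → A * B * (A + B) ≠ 0 → A ≡ -1 [ZMOD 4] → (32 : ℤ) ∣ B →
      (((A * B * (A + B)) ^ 2 : ℤ) : ℝ) ≤ C * ((freyCurve A B).conductorNorm ℤ : ℝ) ^ σ :=
  Summit.ABC.ABC.Theorems.polyAbcNormalized_of_polyDegreeOfBoundedPrimes hB
    (hGlueU hU hJ (hHofMK hMK hMod))

/-- **A alone already buys polynomial abc from B** (the same composition without the route's
U-package: whoever supplies crux A — U, K, or a refutation-free future — turns B into polynomial abc). -/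
theorem polyAbc_of_crux_of_degreePrimes (hB : PolyDegreeOfBoundedPrimes)
    (hA : DegreePrimesPolyBounded) :
    ∃ σ C : ℝ, ∀ A B : ℤ, IsCoprime A B → A * B * (A + B) ≠ 0 → A ≡ -1 [ZMOD 4] → (32 : ℤ) ∣ B →
      (((A * B * (A + B)) ^ 2 : ℤ) : ℝ) ≤ C * ((freyCurve A B).conductorNorm ℤ : ℝ) ^ σ :=
  Summit.ABC.ABC.Theorems.polyAbcNormalized_of_polyDegreeOfBoundedPrimes hB hA

/-- **B ↔ B′ modulo the Manin item** (alias of the landed exactness theorem, p137484): the open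
content of B is exactly the sibling crux `PolyHeightOfBoundedPrimes` (stmt-ABC-16006). -/
theorem crux_iff_residual_of_manin (hMan : SemistableManinBound2) :
    PolyDegreeOfBoundedPrimes ↔ PolyHeightOfBoundedPrimes :=
  Summit.ABC.ABC.Theorems.polyDegreeOfBoundedPrimes_iff_polyHeightOfBoundedPrimes_of_semistableManinBound2
    hMan

/-- **Hypothesis-free exactness** (alias, p137484): `B ↔ (B′ ∧ (A → SMB2))`. -/
theorem crux_iff_residual_and_manin :
    PolyDegreeOfBoundedPrimes ↔
      (PolyHeightOfBoundedPrimes ∧ (DegreePrimesPolyBounded → SemistableManinBound2)) :=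
  Summit.ABC.ABC.Theorems.polyDegreeOfBoundedPrimes_iff_polyHeightOfBoundedPrimes_and_semistableManinBound2

/-! ## Typed forms of the r1 census attempts (definitions only; see STRATEGY-CENSUS.md, Part A) -/

/-- TRANSFER T-r1a (prime-conductor sibling, Mestre–Oesterlé 1989): the consequent `P` of B restricted
to PRIME conductor.  Mod `mestreOesterle1989_thm_1` (`Δ_min ∣ p⁵`) it is the Hall half at prime
conductor (`|c₄|³ ≤ C·p^σ` on `y² = x³ − 1728·(±p^k)`, k ≤ 5) — still open (no power-saving Hall
bound, Elkies 2000 §4.1); the level-lowering step that solves the FINITE half here (empty target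
`S₂(SL₂(ℤ)) = 0`) has a non-empty target `S₂(Γ₀(N/p))` as soon as `ω(N) ≥ 2`. -/
def PolyDegreePrimeConductor : Prop :=
  ∃ κ C : ℝ, ∀ (W : WeierstrassCurve ℚ) [W.IsElliptic] [W.IsGloballyMinimal]
    [NeZero (W.conductorNorm ℤ)], W.IsSemistable ℤ → (W.conductorNorm ℤ).Prime →
    ∃ D : ModularParametrizationData W (W.conductorNorm ℤ),
      (D.modularDegree : ℝ) ≤ C * (W.conductorNorm ℤ : ℝ) ^ κ

/-- STRENGTHEN S⁺-r1a (drop semistability AND the hypothesis A, Faltings-height form): logarithmic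
Faltings height for ALL elliptic curves over ℚ on global minimal models.  Implies B′'s consequent
(`faltingsHeight_le_log_iff_polyHeight`, p116768, gives the semistable height form) hence B mod the
Manin item; adds no induction parameter and no compactness (the statement is asymptotic in N); it is
the logarithmic generalized Szpiro conjecture with a free constant — summit-class. -/
def LogFaltingsHeightAll : Prop :=
  ∃ a b : ℝ, ∀ (W : WeierstrassCurve ℚ) [W.IsElliptic] [W.IsGloballyMinimal]
    [NeZero (W.conductorNorm ℤ)], W.faltingsHeight ≤ a * Real.log (W.conductorNorm ℤ) + b

/-- S⁺-r1a restricted to semistable curves is EXACTLY B′'s consequent (alias of p116768). -/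
theorem logHeight_semistable_iff_polyHeight :
    (∃ a b : ℝ, ∀ (W : WeierstrassCurve ℚ) [W.IsElliptic] [W.IsGloballyMinimal]
        [NeZero (W.conductorNorm ℤ)], W.IsSemistable ℤ →
        W.faltingsHeight ≤ a * Real.log (W.conductorNorm ℤ) + b) ↔
      (∃ σ C : ℝ, ∀ (W : WeierstrassCurve ℚ) [W.IsElliptic] [W.IsGloballyMinimal]
        [NeZero (W.conductorNorm ℤ)], W.IsSemistable ℤ →
        ((max |W.Δ| (|W.c₄| ^ 3) : ℚ) : ℝ) ≤ C * (W.conductorNorm ℤ : ℝ) ^ σ) :=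
  Summit.ABC.ABC.Theorems.faltingsHeight_le_log_iff_polyHeight

/-- S⁺-r1a ⟹ B′ (drop semistability, forget A). -/
theorem residual_of_logFaltingsHeightAll (h : LogFaltingsHeightAll) : PolyHeightOfBoundedPrimes :=
  fun _ => logHeight_semistable_iff_polyHeight.mp
    (by obtain ⟨a, b, hab⟩ := h; exact ⟨a, b, fun W _ _ _ _ => hab W⟩)

/-- S⁺-r1a ⟹ B modulo the Manin item. -/
theorem crux_of_logFaltingsHeightAll_of_manin (hMan : SemistableManinBound2)
    (h : LogFaltingsHeightAll) : PolyDegreeOfBoundedPrimes :=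
  (crux_iff_residual_of_manin hMan).mpr (residual_of_logFaltingsHeightAll h)

end Summit.ABC.ABC.Cruxes.PolyDegreeOfBoundedPrimes.StrategistCensusR1

end
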